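import Literature.Geometry.Lorentzian.AFSobolev
import HarnessLib

/-!
# Uniqueness of decaying solutions of `Δ_h v − f v = h` on an asymptotically flat 3-manifold
# (Schoen–Yau 1979, Lemma 3.2, uniqueness)

Schoen–Yau, Comm. Math. Phys. 65 (1979), **Lemma 3.2** (p. 64): on a one-ended asymptotically
flat `3`-manifold `N` satisfying (1.1), *"there is a number `ε₀ > 0` depending only on `N` and
`k₁, k₂, k₃` of (1.1) so that if `(∫_N |f₋|^{3/2})^{2/3} ≤ ε₀`"* the equation
`Δv − fv = h` ((3.2)) *"has a unique solution `v` defined on `N` satisfying `v = O(1/r)`"*.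
The uniqueness half is the integration by parts of p. 65: for a solution of the homogeneous
equation, *"if `h = 0`, we can apply Lemma 3.1 to obtain `∫ ‖Dv‖² ≤ ε₀ c₁ ∫ ‖Dv‖²`. Thus if we
choose `ε₀ < 1/c₁`, we see that `Δv − fv` has trivial kernel"*, with Lemma 3.1 the Sobolev
inequality `(∫ |ζ|⁶)^{1/3} ≤ c₁ ∫ ‖∇ζ‖²` for compactly supported `ζ` (proved in this tree as
`AFEnd.sobolev_inequality`, `AFSobolev.lean`).

This file **proves** the uniqueness statement on the whole (non-compact) manifold, where the
printed integration by parts needs a cut-off: for the difference `v` of two `O(1/r)` solutions,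
`Δ_h v = f v`, and with the radial cut-offs `χ_ρ = χ(‖coord‖/ρ)` of `EndFluxCutoff.lean`,

* the *localisation identity* `∫ h⁻¹(d(χv), d(χv)) dV = −∫ χ² v Δ_h v dV + ∫ v² h⁻¹(dχ, dχ) dV`
  (`integral_innerDual_mvfderiv_cutoff_mul_eq`, Green's first identity for the compactly supported
  test function `χ² v`, `GreenIdentityCompactSupport.lean`);
* Hölder `∫ f₋ (χv)² ≤ ‖f₋‖_{3/2} ‖χv‖₆²` and the Sobolev inequality give
  `(1 − c₁‖f₋‖_{3/2}) ∫ h⁻¹(d(χ_ρ v), d(χ_ρ v)) ≤ ∫ v² h⁻¹(dχ_ρ, dχ_ρ)`;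
* the right side is `O(1/ρ)`: `|v| ≤ C/r`, `|dχ_ρ| ≤ C₁/ρ` on the annulus `ρ ≤ r ≤ 2ρ` of
  Euclidean volume `O(ρ³)`, the metric being uniformly equivalent to the Euclidean one far out
  (`exists_radius_abs_gramInvSqrtDet_sub_one_le`, `setIntegral_sq_innerDual_radialCutoff_le`);
* hence `‖χ_ρ v‖₆ → 0` as `ρ → ∞`, and `v ≡ 0` (the Riemannian measure charges open sets).

Main results (all proved; no definitions, no named facts):

* `AFEnd.eq_zero_of_dalembertian_eq_mul` — if `(X, h)` satisfies the Sobolev inequality with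
  constant `c₁`, `f` is continuous with `c₁ (∫ f₋^{3/2} dV)^{2/3} < 1`, and `v ∈ C²(X)` solves
  `Δ_h v = f v` with `v ∘ Φ = O(1/r)` in the chart of the (only, asymptotically flat) end, then
  `v = 0`;
* `AFEnd.eq_of_dalembertian_sub_mul_eq` — two `O(1/r)` solutions of `Δ_h v − f v = g` coincide;
* `AFEnd.exists_eps_forall_eq_of_dalembertian_sub_mul_eq` — Schoen–Yau's form: there is
  `ε₀ > 0` depending only on `(X, h, e)` such that `(∫ f₋^{3/2})^{2/3} ≤ ε₀` forces uniqueness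
  (the Sobolev constant supplied by `AFEnd.sobolev_inequality`).

The Sobolev constant enters as an explicit hypothesis in the first two, so that they apply
uniformly to families of metrics with a common constant (the metrics `ds² + t Ric` of the proof
of Schoen–Yau's Thm. 2, pp. 72–74, where the uniqueness of the conformal factors `φ_t` is used).

## References

* R. Schoen, S.-T. Yau, *On the proof of the positive mass conjecture in general relativity*,
  Comm. Math. Phys. 65 (1979) 45–76, Lemma 3.1 (p. 63), Lemma 3.2 (pp. 64–65).
-/

noncomputable section

open Set Function Filter Metric MeasureTheory Measure TopologicalSpace Bornology Asymptotics Manifold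
  Bundle Module
open scoped Topology Manifold ContDiff ENNReal

namespace Literature.Geometry.Lorentzian

section Linearity

variable {E : Type*} [NormedAddCommGroup E] [NormedSpace ℝ E] {H : Type*} [TopologicalSpace H]
  {I : ModelWithCorners ℝ E H} {M : Type*} [TopologicalSpace M] [ChartedSpace H M]
  [IsManifold I ∞ M] [FiniteDimensional ℝ E] [CompleteSpace E] [I.Boundaryless]
  (g : PseudoRiemannianMetric I ∞ E (TangentSpace I : M → Type _)) [g.HasLeviCivita]

/-! ### Linearity of the Laplace–Beltrami operator on `C²` functions -/

/-- **`□_g (f₁ − f₂) = □_g f₁ − □_g f₂`** at a point where `f₁, f₂` are `C²` (for a smooth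
metric on a boundaryless manifold): the coordinate formula `□_g f = ∑ Ĝⁱʲ(∂ᵢ∂ⱼf̂ − Γˡᵢⱼ ∂ₗ f̂)`
(`dalembertian_eq_sum_localFrame`) is linear in the first two derivatives of the chart
representative. O'Neill 1983, Ch. 3, Def. 3.50 ff. [cite: ONeill1983, Ch. 3, Def. 3.50 ff.] -/
theorem dalembertian_sub {f₁ f₂ : M → ℝ} {p : M} (hf₁ : ContMDiffAt I 𝓘(ℝ, ℝ) 2 f₁ p)
    (hf₂ : ContMDiffAt I 𝓘(ℝ, ℝ) 2 f₂ p) :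
    g.dalembertian (f₁ - f₂) p = g.dalembertian f₁ p - g.dalembertian f₂ p := by
  classical
  obtain ⟨b⟩ : Nonempty (Module.Basis (Fin (Module.finrank ℝ E)) ℝ E) := ⟨Module.finBasis ℝ E⟩
  have hp : p ∈ (chartAt H p).source := mem_chart_source H p
  set fh₁ : E → ℝ := f₁ ∘ (extChartAt I p).symm with hfh₁
  set fh₂ : E → ℝ := f₂ ∘ (extChartAt I p).symm with hfh₂
  have hf₁₂ : ContMDiffAt I 𝓘(ℝ, ℝ) 2 (f₁ - f₂) p := hf₁.sub hf₂
  have hr₁ : fh₁ =ᶠ[𝓝 (extChartAt I p p)] f₁ ∘ (extChartAt I p).symm := EventuallyEq.rfl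
  have hr₂ : fh₂ =ᶠ[𝓝 (extChartAt I p p)] f₂ ∘ (extChartAt I p).symm := EventuallyEq.rfl
  have hr₁₂ : (fh₁ - fh₂) =ᶠ[𝓝 (extChartAt I p p)] (f₁ - f₂) ∘ (extChartAt I p).symm :=
    Eventually.of_forall fun _ ↦ rfl
  set Gh : E → Fin (Module.finrank ℝ E) → Fin (Module.finrank ℝ E) → ℝ := fun z i j ↦
    g.val ((extChartAt I p).symm z)
      ((trivializationAt E (TangentSpace I) p).localFrame b i ((extChartAt I p).symm z))
      ((trivializationAt E (TangentSpace I) p).localFrame b j ((extChartAt I p).symm z)) with hGh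
  have hG : ∀ᶠ z in 𝓝 (extChartAt I p p), ∀ i j, Gh z i j =
      g.val ((extChartAt I p).symm z)
        ((trivializationAt E (TangentSpace I) p).localFrame b i ((extChartAt I p).symm z))
        ((trivializationAt E (TangentSpace I) p).localFrame b j ((extChartAt I p).symm z)) :=
    Eventually.of_forall fun _ _ _ ↦ rfl
  have e₁ := dalembertian_eq_sum_localFrame g b hp hf₁ hG hr₁
  have e₂ := dalembertian_eq_sum_localFrame g b hp hf₂ hG hr₂
  have e₁₂ := dalembertian_eq_sum_localFrame g b hp hf₁₂ hG hr₁₂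
  -- derivatives of the representatives at `φ p`
  have hc₁ : ContDiffAt ℝ 2 fh₁ (extChartAt I p p) := contDiffAt_rep hp hf₁ hr₁
  have hc₂ : ContDiffAt ℝ 2 fh₂ (extChartAt I p p) := contDiffAt_rep hp hf₂ hr₂
  have hd1 : fderiv ℝ (fh₁ - fh₂) (extChartAt I p p) =
      fderiv ℝ fh₁ (extChartAt I p p) - fderiv ℝ fh₂ (extChartAt I p p) :=
    fderiv_sub (hc₁.differentiableAt (by simp)) (hc₂.differentiableAt (by simp))
  have hd2 : fderiv ℝ (fderiv ℝ (fh₁ - fh₂)) (extChartAt I p p) =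
      fderiv ℝ (fderiv ℝ fh₁) (extChartAt I p p) - fderiv ℝ (fderiv ℝ fh₂) (extChartAt I p p) := by
    have hev : fderiv ℝ (fh₁ - fh₂) =ᶠ[𝓝 (extChartAt I p p)] fderiv ℝ fh₁ - fderiv ℝ fh₂ := by
      filter_upwards [hc₁.eventually (by simp), hc₂.eventually (by simp)] with z hz₁ hz₂
      exact fderiv_sub (hz₁.differentiableAt (by simp)) (hz₂.differentiableAt (by simp))
    rw [hev.fderiv_eq]
    exact fderiv_sub ((hc₁.fderiv_right (m := 1) le_rfl).differentiableAt (by simp))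
      ((hc₂.fderiv_right (m := 1) le_rfl).differentiableAt (by simp))
  rw [e₁₂, e₁, e₂, hd2, hd1]
  simp only [_root_.sub_apply, mul_sub, Finset.sum_sub_distrib]
  ring

end Linearity

section Algebra

variable {X : Type} [TopologicalSpace X] [ChartedSpace E3 X] [IsManifold (𝓡 3) ∞ X]
  (D : InitialDataSet (𝓡 3) X)

/-! ### The localisation identity -/

/-- **Pointwise localisation identity**: for functions `χ, v` differentiable at `x`,
`h⁻¹(d(χv), d(χv)) = h⁻¹(d(χ²v), dv) + v² h⁻¹(dχ, dχ)` (Leibniz rule and the symmetry of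
`h⁻¹`; here `χ²v` is written `χ (χ v)`). [folklore] -/
theorem innerDual_mvfderiv_mul_self (x : X) {χ v : X → ℝ}
    (hχ : MDifferentiableAt (𝓡 3) 𝓘(ℝ, ℝ) χ x) (hv : MDifferentiableAt (𝓡 3) 𝓘(ℝ, ℝ) v x) :
    D.metric.innerDual x (mvfderiv (𝓡 3) (fun q ↦ χ q * v q) x).toLinearMap
        (mvfderiv (𝓡 3) (fun q ↦ χ q * v q) x).toLinearMap =
      D.metric.innerDual x (mvfderiv (𝓡 3) (fun q ↦ χ q * (χ q * v q)) x).toLinearMap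
        (mvfderiv (𝓡 3) v x).toLinearMap +
      v x ^ 2 * D.metric.innerDual x (mvfderiv (𝓡 3) χ x).toLinearMap
        (mvfderiv (𝓡 3) χ x).toLinearMap := by
  have hχv : MDifferentiableAt (𝓡 3) 𝓘(ℝ, ℝ) (fun q ↦ χ q * v q) x := hχ.mul hv
  have h1 : mvfderiv (𝓡 3) (fun q ↦ χ q * v q) x = χ x • mvfderiv (𝓡 3) v x + v x • mvfderiv (𝓡 3) χ x :=
    mvfderiv_fun_mul hχ hv
  have h2 : mvfderiv (𝓡 3) (fun q ↦ χ q * (χ q * v q)) x =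
      χ x • mvfderiv (𝓡 3) (fun q ↦ χ q * v q) x + (χ x * v x) • mvfderiv (𝓡 3) χ x :=
    mvfderiv_fun_mul hχ hχv
  have hsymm : D.metric.innerDual x (mvfderiv (𝓡 3) v x).toLinearMap (mvfderiv (𝓡 3) χ x).toLinearMap =
      D.metric.innerDual x (mvfderiv (𝓡 3) χ x).toLinearMap (mvfderiv (𝓡 3) v x).toLinearMap := by
    change (PseudoRiemannianMetric.ofRiemannian D.h).innerDual x _ _ =
      (PseudoRiemannianMetric.ofRiemannian D.h).innerDual x _ _
    exact innerDual_comm D.h x _ _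
  rw [h2, h1]
  simp only [ContinuousLinearMap.toLinearMap_add, ContinuousLinearMap.toLinearMap_smul, smul_add,
    PseudoRiemannianMetric.innerDual, map_add, map_smul, LinearMap.add_apply, LinearMap.smul_apply,
    smul_eq_mul] at hsymm ⊢
  rw [hsymm]
  ring

/-- The Dirichlet pairing `h⁻¹(du, dv)` vanishes off the topological support of `u`. [folklore] -/
private theorem innerDual_mvfderiv_eq_zero_of_notMem_tsupport {u v : X → ℝ} {x : X}
    (hx : x ∉ tsupport u) :
    D.metric.innerDual x (mvfderiv (𝓡 3) u x).toLinearMap (mvfderiv (𝓡 3) v x).toLinearMap = 0 := by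
  have hev : u =ᶠ[𝓝 x] fun _ ↦ 0 := notMem_tsupport_iff_eventuallyEq.1 hx
  simp only [PseudoRiemannianMetric.mvfderiv_eq_zero_of_eventuallyEq_zero hev,
    ContinuousLinearMap.toLinearMap_zero, PseudoRiemannianMetric.innerDual, LinearMap.zero_apply]

/-- The Dirichlet pairing `h⁻¹(dv, du)` vanishes off the topological support of `u`. [folklore] -/
private theorem innerDual_mvfderiv_eq_zero_of_notMem_tsupport' {u v : X → ℝ} {x : X}
    (hx : x ∉ tsupport u) :
    D.metric.innerDual x (mvfderiv (𝓡 3) v x).toLinearMap (mvfderiv (𝓡 3) u x).toLinearMap = 0 := by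
  have hev : u =ᶠ[𝓝 x] fun _ ↦ 0 := notMem_tsupport_iff_eventuallyEq.1 hx
  simp only [PseudoRiemannianMetric.mvfderiv_eq_zero_of_eventuallyEq_zero hev,
    ContinuousLinearMap.toLinearMap_zero, PseudoRiemannianMetric.innerDual, map_zero]

end Algebra

section Localisation

variable {X : Type} [TopologicalSpace X] [ChartedSpace E3 X] [IsManifold (𝓡 3) ∞ X]
  [T2Space X] [LocallyCompactSpace X] [SigmaCompactSpace X] [MeasurableSpace X] [BorelSpace X]
  (D : InitialDataSet (𝓡 3) X) [D.metric.HasLeviCivita]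

/-- **The localisation identity** (integrated): for `χ ∈ C¹_c(X)` and `v ∈ C²(X)`,
`∫ h⁻¹(d(χv), d(χv)) dV = −∫ χ² v Δ_h v dV + ∫ v² h⁻¹(dχ, dχ) dV` — Green's first identity
`∫ u Δ_h v = −∫ h⁻¹(du, dv)` (`GreenIdentityCompactSupport.lean`) for the compactly supported
test function `u = χ² v`, and `innerDual_mvfderiv_mul_self`. This is the cut-off form of the
integration by parts "multiply by `v` and integrate by parts" of Schoen–Yau 1979, p. 65.
[cite: SchoenYauPMT1979, proof of Lemma 3.2 (p. 65)] -/
theorem integral_innerDual_mvfderiv_cutoff_mul_eq {χ v : X → ℝ}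
    (hχ : ContMDiff (𝓡 3) 𝓘(ℝ, ℝ) 1 χ) (hχc : HasCompactSupport χ)
    (hv : ContMDiff (𝓡 3) 𝓘(ℝ, ℝ) 2 v) :
    ∫ x, D.metric.innerDual x (mvfderiv (𝓡 3) (fun q ↦ χ q * v q) x).toLinearMap
        (mvfderiv (𝓡 3) (fun q ↦ χ q * v q) x).toLinearMap ∂riemannianMeasure D.h =
      -∫ x, χ x ^ 2 * (v x * D.metric.dalembertian v x) ∂riemannianMeasure D.h +
      ∫ x, v x ^ 2 * D.metric.innerDual x (mvfderiv (𝓡 3) χ x).toLinearMap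
        (mvfderiv (𝓡 3) χ x).toLinearMap ∂riemannianMeasure D.h := by
  classical
  haveI : (PseudoRiemannianMetric.ofRiemannian D.h).HasLeviCivita := ‹D.metric.HasLeviCivita›
  set μ : Measure X := riemannianMeasure D.h with hμ
  haveI : IsFiniteMeasureOnCompacts μ :=
    ⟨fun K hK ↦ riemannianVolume_lt_top_of_isCompact_holds D.h le_rfl hK⟩
  have hv1 : ContMDiff (𝓡 3) 𝓘(ℝ, ℝ) 1 v := hv.of_le (by norm_num)
  have hχv1 : ContMDiff (𝓡 3) 𝓘(ℝ, ℝ) 1 (fun q ↦ χ q * v q) := hχ.mul hv1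
  set u : X → ℝ := fun q ↦ χ q * (χ q * v q) with hu
  have hu1 : ContMDiff (𝓡 3) 𝓘(ℝ, ℝ) 1 u := hχ.mul hχv1
  have huc : HasCompactSupport u := hχc.mul_right
  -- Green's identity for `u = χ² v`
  have hGreen : ∫ x, u x * D.metric.dalembertian v x ∂μ =
      -∫ x, D.metric.innerDual x (mvfderiv (𝓡 3) u x).toLinearMap
        (mvfderiv (𝓡 3) v x).toLinearMap ∂μ :=
    integral_mul_dalembertian_eq_neg_integral_innerDual_of_hasCompactSupport D.h hu1 huc hv
  -- integrability of the two pairings on the right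
  have hc1 : Continuous fun x ↦ D.metric.innerDual x (mvfderiv (𝓡 3) u x).toLinearMap
      (mvfderiv (𝓡 3) v x).toLinearMap := continuous_innerDual_mvfderiv D.metric hu1 hv1
  have hcs1 : HasCompactSupport fun x ↦ D.metric.innerDual x (mvfderiv (𝓡 3) u x).toLinearMap
      (mvfderiv (𝓡 3) v x).toLinearMap :=
    HasCompactSupport.intro huc fun x hx ↦ innerDual_mvfderiv_eq_zero_of_notMem_tsupport D hx
  have hi1 := hc1.integrable_of_hasCompactSupport (μ := μ) hcs1
  have hc2 : Continuous fun x ↦ v x ^ 2 * D.metric.innerDual x (mvfderiv (𝓡 3) χ x).toLinearMap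
      (mvfderiv (𝓡 3) χ x).toLinearMap :=
    (hv.continuous.pow 2).mul (continuous_innerDual_mvfderiv D.metric hχ hχ)
  have hcs2 : HasCompactSupport fun x ↦ v x ^ 2 * D.metric.innerDual x
      (mvfderiv (𝓡 3) χ x).toLinearMap (mvfderiv (𝓡 3) χ x).toLinearMap := by
    refine HasCompactSupport.intro hχc fun x hx ↦ ?_
    rw [innerDual_mvfderiv_eq_zero_of_notMem_tsupport D hx, mul_zero]
  have hi2 := hc2.integrable_of_hasCompactSupport (μ := μ) hcs2
  -- pointwise identity, integrated
  have hpt : ∀ x, D.metric.innerDual x (mvfderiv (𝓡 3) (fun q ↦ χ q * v q) x).toLinearMap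
      (mvfderiv (𝓡 3) (fun q ↦ χ q * v q) x).toLinearMap =
      D.metric.innerDual x (mvfderiv (𝓡 3) u x).toLinearMap (mvfderiv (𝓡 3) v x).toLinearMap +
      v x ^ 2 * D.metric.innerDual x (mvfderiv (𝓡 3) χ x).toLinearMap
        (mvfderiv (𝓡 3) χ x).toLinearMap := fun x ↦
    innerDual_mvfderiv_mul_self D x (hχ.mdifferentiableAt one_ne_zero)
      (hv1.mdifferentiableAt one_ne_zero)
  have huΔ : ∫ x, χ x ^ 2 * (v x * D.metric.dalembertian v x) ∂μ =
      ∫ x, u x * D.metric.dalembertian v x ∂μ := by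
    refine integral_congr_ae (Eventually.of_forall fun x ↦ ?_)
    simp only [hu]
    ring
  rw [integral_congr_ae (Eventually.of_forall hpt), integral_add hi1 hi2, huΔ, hGreen, neg_neg]

end Localisation

namespace AFEnd

variable {X : Type} [TopologicalSpace X] [ChartedSpace E3 X] [IsManifold (𝓡 3) ∞ X]
  [T2Space X] [LocallyCompactSpace X] [SigmaCompactSpace X] [MeasurableSpace X] [BorelSpace X]
  (e : AFEnd X) (D : InitialDataSet (𝓡 3) X) [D.metric.HasLeviCivita]

/-! ### The cut-off error `∫ v² h⁻¹(dχ_ρ, dχ_ρ) dV = O(1/ρ)` -/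

/-- **The cut-off error is `O(1/ρ)`.** Let `χ` be a radial profile (`χ = 1` on `(−∞, 1]`,
`χ = 0` on `[2, ∞)`, `|χ'| ≤ C₁`), `R₂ > R` a radius beyond which the inverse metric times the
density is `1/6`-close to `δ` in the chart of the end, and `v : X → ℝ` with `|v ∘ Φ| ≤ C_v/r`
beyond `R₂`. Then for `ρ > R₂` the cut-off `χ_ρ = χ(‖coord‖/ρ)` satisfies
`∫_X v² h⁻¹(dχ_ρ, dχ_ρ) dV ≤ 84 C₁² C_v² |B₁| / ρ` (`|B₁|` the volume of the unit ball of `ℝ³`):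
the integrand lives on the image of the annulus `ρ ≤ ‖z‖ ≤ 2ρ`, where in the chart it is
`(v ∘ Φ)² ∑ₖₗ (h_{ij})⁻¹ₖₗ √(det h_{ij}) ∂ₖχ_ρ ∂ₗχ_ρ ≤ (C_v/ρ)² · 9 · (7/6) · (C₁/ρ)²`, against the
Euclidean volume `8ρ³ |B₁|` of the ball of radius `2ρ`. [cite: SchoenYauPMT1979, proof of
Lemma 3.2 (p. 65)] -/
theorem integral_sq_mul_innerDual_radialCutoff_le
    {χ : ℝ → ℝ} (hχ : ContDiff ℝ ∞ χ) (h1 : ∀ s, s ≤ 1 → χ s = 1) (h2 : ∀ s, 2 ≤ s → χ s = 0)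
    {C₁ : ℝ} (hC₁ : 0 ≤ C₁) (hdχ : ∀ s, |deriv χ s| ≤ C₁) {R₂ : ℝ} (hRR₂ : e.R < R₂)
    (hW : ∀ z : E3, R₂ ≤ ‖z‖ → ∀ k l,
      |(Matrix.of fun i j ↦ hCoeff e D z (EuclideanSpace.single i 1)
          (EuclideanSpace.single j 1) : Matrix (Fin 3) (Fin 3) ℝ)⁻¹ k l *
        Real.sqrt (Matrix.of fun i j ↦ hCoeff e D z (EuclideanSpace.single i 1)
          (EuclideanSpace.single j 1) : Matrix (Fin 3) (Fin 3) ℝ).det -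
        (1 : Matrix (Fin 3) (Fin 3) ℝ) k l| ≤ 1 / 6)
    {v : X → ℝ} {Cv : ℝ} (hCv : 0 ≤ Cv)
    (hvb : ∀ z : E3, R₂ ≤ ‖z‖ → |endValue e v z| ≤ Cv / ‖z‖) {ρ : ℝ} (hρ : R₂ < ρ) :
    ∫ x, v x ^ 2 * D.metric.innerDual x
        (mvfderiv (𝓡 3) (fun q ↦ χ (‖e.coord q‖ / ρ)) x).toLinearMap
        (mvfderiv (𝓡 3) (fun q ↦ χ (‖e.coord q‖ / ρ)) x).toLinearMap ∂riemannianMeasure D.h ≤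
      84 * C₁ ^ 2 * Cv ^ 2 * (volume (closedBall (0 : E3) 1)).toReal / ρ := by
  classical
  set μ : Measure X := riemannianMeasure D.h with hμ
  set H : E3 → Matrix (Fin 3) (Fin 3) ℝ := fun z ↦ Matrix.of fun i j ↦
    hCoeff e D z (EuclideanSpace.single i 1) (EuclideanSpace.single j 1) with hHdef
  set dens : E3 → ℝ := fun z ↦ Real.sqrt (H z).det with hdens
  have hρR : e.R < ρ := hRR₂.trans hρ
  have hρ0 : 0 < ρ := e.R_pos.trans hρR
  have hR₂0 : 0 < R₂ := e.R_pos.trans hRR₂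
  set χρ : X → ℝ := fun q ↦ χ (‖e.coord q‖ / ρ) with hχρ
  have hχρs : ContMDiff (𝓡 3) 𝓘(ℝ, ℝ) ∞ χρ := e.contMDiff_radialCutoff hχ h1 hρR
  set g : X → ℝ := fun x ↦ v x ^ 2 * D.metric.innerDual x (mvfderiv (𝓡 3) χρ x).toLinearMap
    (mvfderiv (𝓡 3) χρ x).toLinearMap with hg
  -- (1) the integrand is supported in `far R₂`
  have hsupp : support g ⊆ e.far R₂ := by
    intro x hx
    rw [mem_support] at hx
    by_contra hfar
    apply hx
    simp only [hg]
    rw [e.mvfderiv_radialCutoff_eq_zero h1 hρR (e.not_mem_closedFar_of_not_mem_far hρ hfar)]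
    simp [PseudoRiemannianMetric.innerDual]
  -- (2) the integral in the chart of the end
  set G : E3 → ℝ := fun z ↦ g (e.dataChartExt z) * dens z with hGdef
  have hchart : ∫ x, g x ∂μ = ∫ z in {z : E3 | R₂ < ‖z‖}, G z :=
    e.integral_eq_setIntegral_far D hRR₂.le hsupp
  -- the chart formula for the integrand at `z`, `R₂ < ‖z‖`
  have hGz : ∀ z : E3, R₂ < ‖z‖ → G z = endValue e v z ^ 2 *
      (∑ l, ∑ k, (H z)⁻¹ k l * fderiv ℝ (fun y : E3 ↦ χ (‖y‖ / ρ)) z (EuclideanSpace.single k 1) *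
        fderiv ℝ (fun y : E3 ↦ χ (‖y‖ / ρ)) z (EuclideanSpace.single l 1)) * dens z := by
    intro z hz
    have hzR : e.R < ‖z‖ := hRR₂.trans hz
    have hmd : MDifferentiableAt (𝓡 3) 𝓘(ℝ, ℝ) χρ (e.dataChart ⟨z, hzR⟩) :=
      (hχρs _).mdifferentiableAt (by simp)
    have hev : endValue e χρ =ᶠ[𝓝 z] fun y : E3 ↦ χ (‖y‖ / ρ) := by
      filter_upwards [(isOpen_lt continuous_const continuous_norm).mem_nhds hzR] with y hy
      exact e.endValue_radialCutoff ρ hy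
    simp only [hGdef, hg]
    rw [e.dataChartExt_of_lt hzR, e.innerDual_mvfderiv_dataChart D ⟨z, hzR⟩ hmd hmd, hev.fderiv_eq,
      ← endValue_of_lt e v hzR]
  -- (3) `G = 0` off the annulus `ρ ≤ ‖z‖ ≤ 2ρ`
  have hG0 : ∀ z : E3, R₂ < ‖z‖ → (‖z‖ < ρ ∨ 2 * ρ < ‖z‖) → G z = 0 := by
    intro z hz hann
    rw [hGz z hz]
    simp [fderiv_radialProfile_norm_div_eq_zero h1 h2 hρ0 hann]
  -- (4) the bound on the annulus
  set B : ℝ := 21 / 2 * C₁ ^ 2 * Cv ^ 2 / ρ ^ 4 with hB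
  have hB0 : 0 ≤ B := by positivity
  have hGle : ∀ z : E3, R₂ < ‖z‖ → |G z| ≤ B := by
    intro z hz
    by_cases hann : ‖z‖ < ρ ∨ 2 * ρ < ‖z‖
    · rw [hG0 z hz hann, abs_zero]
      exact hB0
    push Not at hann
    obtain ⟨hzρ, -⟩ := hann
    have hzn : 0 < ‖z‖ := hρ0.trans_le hzρ
    set a : Fin 3 → ℝ := fun k ↦ fderiv ℝ (fun y : E3 ↦ χ (‖y‖ / ρ)) z (EuclideanSpace.single k 1)
      with ha
    have hak : ∀ k, |a k| ≤ C₁ / ρ := fun k ↦ by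
      have h := (fderiv ℝ (fun y : E3 ↦ χ (‖y‖ / ρ)) z).le_opNorm (EuclideanSpace.single k 1)
      have hel : ‖(EuclideanSpace.single k (1 : ℝ) : E3)‖ = 1 := by simp
      rw [hel, mul_one, Real.norm_eq_abs] at h
      exact h.trans (norm_fderiv_radialProfile_norm_div_le hχ h1 hC₁ hdχ hρ0 z)
    have hWz : ∀ k l, |(H z)⁻¹ k l * dens z| ≤ 7 / 6 := fun k l ↦ by
      have h := hW z hz.le k l
      have hδ : |(1 : Matrix (Fin 3) (Fin 3) ℝ) k l| ≤ 1 := by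
        rw [Matrix.one_apply]
        split_ifs <;> simp
      have := abs_sub_abs_le_abs_sub ((H z)⁻¹ k l * dens z) ((1 : Matrix (Fin 3) (Fin 3) ℝ) k l)
      linarith
    -- the double sum
    have hsum : |(∑ l, ∑ k, (H z)⁻¹ k l * a k * a l) * dens z| ≤ 21 / 2 * (C₁ / ρ) ^ 2 := by
      have heq : (∑ l, ∑ k, (H z)⁻¹ k l * a k * a l) * dens z =
          ∑ l, ∑ k, ((H z)⁻¹ k l * dens z) * (a k * a l) := by
        rw [Finset.sum_mul]
        refine Finset.sum_congr rfl fun l _ ↦ ?_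
        rw [Finset.sum_mul]
        refine Finset.sum_congr rfl fun k _ ↦ ?_
        ring
      rw [heq]
      calc |∑ l, ∑ k, ((H z)⁻¹ k l * dens z) * (a k * a l)|
          ≤ ∑ l, ∑ k, |((H z)⁻¹ k l * dens z) * (a k * a l)| :=
            (Finset.abs_sum_le_sum_abs _ _).trans
              (Finset.sum_le_sum fun l _ ↦ Finset.abs_sum_le_sum_abs _ _)
        _ ≤ ∑ _l : Fin 3, ∑ _k : Fin 3, 7 / 6 * ((C₁ / ρ) * (C₁ / ρ)) := by
            refine Finset.sum_le_sum fun l _ ↦ Finset.sum_le_sum fun k _ ↦ ?_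
            rw [abs_mul, abs_mul (a k)]
            exact mul_le_mul (hWz k l) (mul_le_mul (hak k) (hak l) (abs_nonneg _)
              (by positivity)) (by positivity) (by norm_num)
        _ = 21 / 2 * (C₁ / ρ) ^ 2 := by
            simp only [Finset.sum_const, Finset.card_univ, Fintype.card_fin, nsmul_eq_mul]
            ring
    have hVz : endValue e v z ^ 2 ≤ (Cv / ρ) ^ 2 := by
      have hb := hvb z hz.le
      have hle : Cv / ‖z‖ ≤ Cv / ρ := div_le_div_of_nonneg_left hCv hρ0 hzρ
      have h0 : 0 ≤ Cv / ρ := by positivity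
      rw [← sq_abs]
      exact pow_le_pow_left₀ (abs_nonneg _) (hb.trans hle) 2
    rw [hGz z hz, mul_assoc, abs_mul, abs_of_nonneg (sq_nonneg _)]
    calc endValue e v z ^ 2 * |(∑ l, ∑ k, (H z)⁻¹ k l * a k * a l) * dens z|
        ≤ (Cv / ρ) ^ 2 * (21 / 2 * (C₁ / ρ) ^ 2) :=
          mul_le_mul hVz hsum (abs_nonneg _) (by positivity)
      _ = B := by
          simp only [hB]
          field_simp
  -- (5) integrate over the ball of radius `2ρ`
  set S : Set E3 := {z : E3 | R₂ < ‖z‖} with hS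
  have hSm : MeasurableSet S := (isOpen_lt continuous_const continuous_norm).measurableSet
  have hrestr : ∫ z in S, G z = ∫ z in S ∩ closedBall (0 : E3) (2 * ρ), G z := by
    refine setIntegral_eq_of_subset_of_forall_sdiff_eq_zero hSm inter_subset_left fun z hz ↦ ?_
    have hzS : z ∈ S := hz.1
    have hzb : z ∉ closedBall (0 : E3) (2 * ρ) := fun h ↦ hz.2 ⟨hzS, h⟩
    rw [mem_closedBall_zero_iff, not_le] at hzb
    exact hG0 z hzS (Or.inr hzb)
  have hvolB : volume (closedBall (0 : E3) (2 * ρ)) =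
      ENNReal.ofReal ((2 * ρ) ^ 3) * volume (closedBall (0 : E3) 1) := by
    rw [Measure.addHaar_closedBall' volume (0 : E3) (by positivity : (0 : ℝ) ≤ 2 * ρ),
      finrank_euclideanSpace_fin]
  have hvolB_lt : volume (closedBall (0 : E3) (2 * ρ)) < (⊤ : ℝ≥0∞) :=
    (isCompact_closedBall _ _).measure_lt_top
  have hSB_lt : volume (S ∩ closedBall (0 : E3) (2 * ρ)) < (⊤ : ℝ≥0∞) :=
    (measure_mono inter_subset_right).trans_lt hvolB_lt
  have hbound : ‖∫ z in S ∩ closedBall (0 : E3) (2 * ρ), G z‖ ≤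
      B * (volume : Measure E3).real (S ∩ closedBall (0 : E3) (2 * ρ)) :=
    norm_setIntegral_le_of_norm_le_const hSB_lt fun z hz ↦ by
      rw [Real.norm_eq_abs]
      exact hGle z hz.1
  have hreal : (volume : Measure E3).real (S ∩ closedBall (0 : E3) (2 * ρ)) ≤
      (2 * ρ) ^ 3 * (volume (closedBall (0 : E3) 1)).toReal := by
    have h1' : (volume : Measure E3).real (S ∩ closedBall (0 : E3) (2 * ρ)) ≤
        (volume : Measure E3).real (closedBall (0 : E3) (2 * ρ)) :=
      measureReal_mono inter_subset_right hvolB_lt.ne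
    refine h1'.trans (le_of_eq ?_)
    rw [measureReal_def, hvolB, ENNReal.toReal_mul, ENNReal.toReal_ofReal (by positivity)]
  calc ∫ x, g x ∂μ = ∫ z in S ∩ closedBall (0 : E3) (2 * ρ), G z := by rw [hchart, hrestr]
    _ ≤ ‖∫ z in S ∩ closedBall (0 : E3) (2 * ρ), G z‖ := Real.le_norm_self _
    _ ≤ B * ((2 * ρ) ^ 3 * (volume (closedBall (0 : E3) 1)).toReal) :=
        hbound.trans (mul_le_mul_of_nonneg_left hreal hB0)
    _ = 84 * C₁ ^ 2 * Cv ^ 2 * (volume (closedBall (0 : E3) 1)).toReal / ρ := by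
        simp only [hB]
        field_simp
        ring

/-! ### Uniqueness (Schoen–Yau 1979, Lemma 3.2) -/

/-- **Schoen–Yau 1979, Lemma 3.2, uniqueness, with an explicit Sobolev constant.** Let `X` be
a `3`-manifold with data `(h, k)`, `e` its only end, asymptotically flat
(`h − δ = O₂(r^{−α})`, `α > 0`), and suppose `(X, h)` satisfies the Sobolev inequality
`(∫ |ζ|⁶ dV)^{1/3} ≤ c₁ ∫ h⁻¹(dζ, dζ) dV` for `ζ ∈ C¹_c(X)` (Lemma 3.1; `AFEnd.sobolev_inequality`).
Let `f` be continuous with negative part `f₋ = max(−f, 0)` satisfying `∫ f₋^{3/2} dV < ∞` and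
`c₁ (∫ f₋^{3/2} dV)^{2/3} < 1`. If `v ∈ C²(X)` solves `Δ_h v = f v` on `X` and `v ∘ Φ = O(1/r)`
in the chart of the end, then `v = 0`. Proof in the module docstring (localisation identity,
Hölder, Sobolev, the `O(1/ρ)` cut-off error, positivity of `dV` on open sets); in print:
"if `h = 0`, we can apply Lemma 3.1 to obtain `∫ ‖Dv‖² ≤ ε₀ c₁ ∫ ‖Dv‖²`. Thus if we choose
`ε₀ < 1/c₁`, we see that `Δv − fv` has trivial kernel" (p. 65).
[cite: SchoenYauPMT1979, Lemma 3.2 (pp. 64–65)] -/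
theorem eq_zero_of_dalembertian_eq_mul {α : ℝ} (hα : 0 < α)
    (hAF : e.IsMetricAsymptoticallyFlat D α) (hsole : e.IsSoleEnd) {c₁ : ℝ}
    (hS : ∀ ζ : X → ℝ, ContMDiff (𝓡 3) 𝓘(ℝ, ℝ) 1 ζ → HasCompactSupport ζ →
      (∫ x, |ζ x| ^ 6 ∂riemannianMeasure D.h) ^ (1 / 3 : ℝ) ≤
        c₁ * ∫ x, D.metric.innerDual x (mvfderiv (𝓡 3) ζ x).toLinearMap
          (mvfderiv (𝓡 3) ζ x).toLinearMap ∂riemannianMeasure D.h)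
    {f : X → ℝ} (hf : Continuous f)
    (hfi : Integrable (fun x ↦ max (-f x) 0 ^ (3 / 2 : ℝ)) (riemannianMeasure D.h))
    (hθ : c₁ * (∫ x, max (-f x) 0 ^ (3 / 2 : ℝ) ∂riemannianMeasure D.h) ^ (2 / 3 : ℝ) < 1)
    {v : X → ℝ} (hv : ContMDiff (𝓡 3) 𝓘(ℝ, ℝ) 2 v)
    (hpde : ∀ x, D.metric.dalembertian v x = f x * v x)
    (hdec : endValue e v =O[cobounded E3] fun z ↦ ‖z‖⁻¹) :
    v = 0 := by
  classical
  haveI : (PseudoRiemannianMetric.ofRiemannian D.h).HasLeviCivita := ‹D.metric.HasLeviCivita›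
  set μ : Measure X := riemannianMeasure D.h with hμ
  haveI : IsFiniteMeasureOnCompacts μ :=
    ⟨fun K hK ↦ riemannianVolume_lt_top_of_isCompact_holds D.h le_rfl hK⟩
  haveI : μ.IsOpenPosMeasure := isOpenPosMeasure_riemannianMeasure D.h
  -- notation: the Dirichlet integrand, the negative part `f₋`, the norm `N = ‖f₋‖_{3/2}`
  set ID : (X → ℝ) → X → ℝ := fun ζ x ↦ D.metric.innerDual x (mvfderiv (𝓡 3) ζ x).toLinearMap
    (mvfderiv (𝓡 3) ζ x).toLinearMap with hID
  have hID0 : ∀ ζ x, 0 ≤ ID ζ x := fun ζ x ↦ innerDual_self_nonneg D.h x _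
  set fm : X → ℝ := fun x ↦ max (-f x) 0 with hfm
  have hfm0 : ∀ x, 0 ≤ fm x := fun x ↦ le_max_right _ _
  have hfmc : Continuous fm := hf.neg.max continuous_const
  set N : ℝ := (∫ x, fm x ^ (3 / 2 : ℝ) ∂μ) ^ (2 / 3 : ℝ) with hN
  have hN0 : 0 ≤ N := Real.rpow_nonneg (integral_nonneg fun x ↦ Real.rpow_nonneg (hfm0 x) _) _
  -- w.l.o.g. the Sobolev constant is nonnegative
  set c : ℝ := max c₁ 0 with hc
  have hc0 : 0 ≤ c := le_max_right _ _
  have hS' : ∀ ζ : X → ℝ, ContMDiff (𝓡 3) 𝓘(ℝ, ℝ) 1 ζ → HasCompactSupport ζ →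
      (∫ x, |ζ x| ^ 6 ∂μ) ^ (1 / 3 : ℝ) ≤ c * ∫ x, ID ζ x ∂μ := fun ζ hζ hζc ↦
    (hS ζ hζ hζc).trans (mul_le_mul_of_nonneg_right (le_max_left _ _)
      (integral_nonneg (hID0 ζ)))
  set θ : ℝ := c * N with hθdef
  have hθ0 : 0 ≤ θ := mul_nonneg hc0 hN0
  have hθ1 : θ < 1 := by
    rcases le_total 0 c₁ with h | h
    · simp only [hθdef, hc, max_eq_left h]
      exact hθ
    · simp only [hθdef, hc, max_eq_right h, zero_mul]
      exact zero_lt_one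
  have hv1 : ContMDiff (𝓡 3) 𝓘(ℝ, ℝ) 1 v := hv.of_le (by norm_num)
  have hvc : Continuous v := hv.continuous
  -- `f₋ ∈ L^{3/2}`
  have hfmLp : MemLp fm (ENNReal.ofReal (3 / 2)) μ := by
    have h := (integrable_norm_rpow_iff (μ := μ) hfmc.aestronglyMeasurable
      (p := ENNReal.ofReal (3 / 2)) (by simp) (by simp)).1
    refine h ?_
    rw [ENNReal.toReal_ofReal (by norm_num : (0 : ℝ) ≤ 3 / 2)]
    refine hfi.congr (Eventually.of_forall fun x ↦ ?_)
    change max (-f x) 0 ^ (3 / 2 : ℝ) = ‖fm x‖ ^ (3 / 2 : ℝ)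
    rw [Real.norm_eq_abs, abs_of_nonneg (hfm0 x)]
  -- the profile and the radii
  obtain ⟨χ, hχ, h1, h2, hχb⟩ := exists_radialProfile
  obtain ⟨C₁, hC₁, hdχ⟩ := exists_bound_deriv_radialProfile hχ h1 h2
  obtain ⟨ρE, hρE⟩ := e.exists_radius_abs_gramInvSqrtDet_sub_one_le D hα hAF
    (by norm_num : (0 : ℝ) < 1 / 6)
  obtain ⟨Cv, hCv0, hCvO⟩ := hdec.exists_nonneg
  obtain ⟨Rv, -, hRv⟩ := (hasBasis_cobounded_norm (E := E3)).eventually_iff.1 hCvO.bound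
  set R₂ : ℝ := max (e.R + 1) (max ρE Rv) with hR₂
  have hRR₂ : e.R < R₂ := by
    have : e.R + 1 ≤ R₂ := le_max_left _ _
    linarith
  have hW : ∀ z : E3, R₂ ≤ ‖z‖ → ∀ k l,
      |(Matrix.of fun i j ↦ hCoeff e D z (EuclideanSpace.single i 1)
          (EuclideanSpace.single j 1) : Matrix (Fin 3) (Fin 3) ℝ)⁻¹ k l *
        Real.sqrt (Matrix.of fun i j ↦ hCoeff e D z (EuclideanSpace.single i 1)
          (EuclideanSpace.single j 1) : Matrix (Fin 3) (Fin 3) ℝ).det -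
        (1 : Matrix (Fin 3) (Fin 3) ℝ) k l| ≤ 1 / 6 := fun z hz ↦
    hρE z (((le_max_left _ _).trans (le_max_right _ _)).trans hz)
  have hvb : ∀ z : E3, R₂ ≤ ‖z‖ → |endValue e v z| ≤ Cv / ‖z‖ := by
    intro z hz
    have hzv : Rv ≤ ‖z‖ := ((le_max_right _ _).trans (le_max_right _ _)).trans hz
    have h := hRv (show z ∈ {x : E3 | Rv ≤ ‖x‖} from hzv)
    rw [Real.norm_eq_abs, norm_inv, norm_norm] at h
    rw [div_eq_mul_inv]
    exact h
  set K : ℝ := 84 * C₁ ^ 2 * Cv ^ 2 * (volume (closedBall (0 : E3) 1)).toReal with hK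
  have hK0 : 0 ≤ K := by positivity
  -- Hölder exponents `3/2` and `3`
  have hpq : (3 / 2 : ℝ).HolderConjugate 3 := Real.holderConjugate_iff.2 ⟨by norm_num, by norm_num⟩
  -- the key estimate: `∫ |χ_ρ v|⁶ ≤ (c K / ((1 − θ) ρ))³` for `ρ > R₂`
  have hkey : ∀ ρ : ℝ, R₂ < ρ →
      ∫ x, |χ (‖e.coord x‖ / ρ) * v x| ^ 6 ∂μ ≤ (c * K / ((1 - θ) * ρ)) ^ 3 := by
    intro ρ hρ
    have hρR : e.R < ρ := hRR₂.trans hρ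
    have hρ0 : 0 < ρ := e.R_pos.trans hρR
    set χρ : X → ℝ := fun q ↦ χ (‖e.coord q‖ / ρ) with hχρ
    have hχρs : ContMDiff (𝓡 3) 𝓘(ℝ, ℝ) ∞ χρ := e.contMDiff_radialCutoff hχ h1 hρR
    have hχρ1 : ContMDiff (𝓡 3) 𝓘(ℝ, ℝ) 1 χρ := hχρs.of_le (by exact_mod_cast le_top)
    have hχρc : HasCompactSupport χρ := e.hasCompactSupport_radialCutoff h2 hsole hρ0
    have hχρcont : Continuous χρ := hχρ1.continuous
    set w : X → ℝ := fun q ↦ χρ q * v q with hw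
    have hw1 : ContMDiff (𝓡 3) 𝓘(ℝ, ℝ) 1 w := hχρ1.mul hv1
    have hwc : HasCompactSupport w := hχρc.mul_right
    have hwcont : Continuous w := hw1.continuous
    -- the energies
    set E : ℝ := ∫ x, ID w x ∂μ with hE
    have hE0 : 0 ≤ E := integral_nonneg (hID0 w)
    set T : ℝ := ∫ x, v x ^ 2 * ID χρ x ∂μ with hT
    have hTK : T ≤ K / ρ :=
      e.integral_sq_mul_innerDual_radialCutoff_le D hχ h1 h2 hC₁ hdχ hRR₂ hW hCv0 hvb hρ
    -- (i) localisation
    have hIMS : E = -∫ x, χρ x ^ 2 * (v x * D.metric.dalembertian v x) ∂μ + T :=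
      integral_innerDual_mvfderiv_cutoff_mul_eq D hχρ1 hχρc hv
    -- (ii) `−∫ χ² v Δv = −∫ χ² f v² ≤ ∫ f₋ w²`
    have hi_l : Integrable (fun x ↦ -(χρ x ^ 2 * (v x * D.metric.dalembertian v x))) μ := by
      refine (Continuous.integrable_of_hasCompactSupport ?_ ?_)
      · exact ((hχρcont.pow 2).mul (hvc.mul (continuous_dalembertian
          (PseudoRiemannianMetric.ofRiemannian D.h) hv))).neg
      · exact (hχρc.comp_left (g := fun t : ℝ ↦ t ^ 2) (by simp)).mul_right.neg
    have hw2c : HasCompactSupport fun x ↦ w x ^ 2 :=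
      hwc.comp_left (g := fun t : ℝ ↦ t ^ 2) (by simp)
    have hi_r : Integrable (fun x ↦ fm x * w x ^ 2) μ :=
      (hfmc.mul (hwcont.pow 2)).integrable_of_hasCompactSupport hw2c.mul_left
    have hA : -∫ x, χρ x ^ 2 * (v x * D.metric.dalembertian v x) ∂μ ≤ ∫ x, fm x * w x ^ 2 ∂μ := by
      rw [← integral_neg]
      refine integral_mono hi_l hi_r fun x ↦ ?_
      have hx : -(χρ x ^ 2 * (v x * D.metric.dalembertian v x)) = (-f x) * w x ^ 2 := by
        rw [hpde x]
        simp only [hw]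
        ring
      rw [hx]
      exact mul_le_mul_of_nonneg_right (le_max_left _ _) (sq_nonneg _)
    -- (iii) Hölder
    have hw2Lp : MemLp (fun x ↦ w x ^ 2) (ENNReal.ofReal 3) μ :=
      (hwcont.pow 2).memLp_of_hasCompactSupport hw2c
    have hw6 : ∀ x, (w x ^ 2) ^ (3 : ℝ) = |w x| ^ 6 := fun x ↦ by
      rw [← sq_abs (w x), show (3 : ℝ) = ((3 : ℕ) : ℝ) by norm_num, Real.rpow_natCast, ← pow_mul]
    have hHolder : ∫ x, fm x * w x ^ 2 ∂μ ≤ N * (∫ x, |w x| ^ 6 ∂μ) ^ (1 / 3 : ℝ) := by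
      have h := integral_mul_le_Lp_mul_Lq_of_nonneg hpq (Eventually.of_forall hfm0)
        (Eventually.of_forall fun x ↦ sq_nonneg (w x)) hfmLp hw2Lp
      have hN' : (∫ x, fm x ^ (3 / 2 : ℝ) ∂μ) ^ (1 / (3 / 2) : ℝ) = N := by
        rw [hN]
        norm_num
      rw [hN', integral_congr_ae (Eventually.of_forall hw6)] at h
      exact h
    -- (iv) Sobolev
    have hSob : (∫ x, |w x| ^ 6 ∂μ) ^ (1 / 3 : ℝ) ≤ c * E := hS' w hw1 hwc
    -- (v) combine: `E ≤ θ E + T`, so `E ≤ T/(1 − θ) ≤ K/((1 − θ) ρ)`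
    have hEle : E ≤ θ * E + T := by
      have h1' : ∫ x, fm x * w x ^ 2 ∂μ ≤ N * (c * E) :=
        hHolder.trans (mul_le_mul_of_nonneg_left hSob hN0)
      rw [hIMS]
      nlinarith
    have hE' : E ≤ K / ((1 - θ) * ρ) := by
      have h1θ : 0 < 1 - θ := sub_pos.2 hθ1
      have h1' : E ≤ T / (1 - θ) := by
        rw [le_div_iff₀ h1θ]
        nlinarith
      have h2' : T / (1 - θ) ≤ K / ρ / (1 - θ) := div_le_div_of_nonneg_right hTK h1θ.le
      rw [mul_comm, ← div_div]
      exact h1'.trans h2'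
    -- (vi) `∫ |w|⁶ ≤ (c K/((1 − θ) ρ))³`
    have hI0 : 0 ≤ ∫ x, |w x| ^ 6 ∂μ := integral_nonneg fun x ↦ by positivity
    have hroot : (∫ x, |w x| ^ 6 ∂μ) ^ (1 / 3 : ℝ) ≤ c * K / ((1 - θ) * ρ) := by
      refine hSob.trans ?_
      rw [mul_div_assoc]
      exact mul_le_mul_of_nonneg_left hE' hc0
    have hcube : ∫ x, |w x| ^ 6 ∂μ = ((∫ x, |w x| ^ 6 ∂μ) ^ (1 / 3 : ℝ)) ^ 3 := by
      rw [← Real.rpow_natCast, ← Real.rpow_mul hI0]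
      norm_num
    rw [hcube]
    exact pow_le_pow_left₀ (Real.rpow_nonneg hI0 _) hroot 3
  -- conclusion: `v = 0` — otherwise `|v| > a > 0` on an open set `U` of positive finite measure,
  -- and `∫_U |χ_ρ v|⁶ → ∫_U |v|⁶ > 0` while `∫ |χ_ρ v|⁶ → 0`
  funext q₀
  by_contra hq₀
  change v q₀ ≠ 0 at hq₀
  set a : ℝ := |v q₀| / 2 with ha
  have ha0 : 0 < a := by
    have := abs_pos.2 hq₀
    positivity
  obtain ⟨O, hOo, hq₀O, hOc⟩ := exists_isOpen_superset_and_isCompact_closure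
    (isCompact_singleton (x := q₀))
  have hq₀O' : q₀ ∈ O := hq₀O (mem_singleton q₀)
  set U : Set X := O ∩ {x | a < |v x|} with hU
  have hUo : IsOpen U := hOo.inter (isOpen_lt continuous_const hvc.abs)
  have hUm : MeasurableSet U := hUo.measurableSet
  have hq₀U : q₀ ∈ U := ⟨hq₀O', by
    change a < |v q₀|
    have := abs_pos.2 hq₀
    rw [ha]
    linarith⟩
  have hμU : 0 < μ U := hUo.measure_pos μ ⟨q₀, hq₀U⟩
  have hμUlt : μ U < ⊤ :=
    (measure_mono (inter_subset_left.trans subset_closure)).trans_lt hOc.measure_lt_top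
  have hμUreal : 0 < μ.real U := ENNReal.toReal_pos hμU.ne' hμUlt.ne
  obtain ⟨Bv, hBv⟩ := hOc.exists_bound_of_continuousOn hvc.continuousOn
  -- the limit `∫_U |χ_ρ v|⁶ → ∫_U |v|⁶`
  set L : ℝ := ∫ x in U, |v x| ^ 6 ∂μ with hL
  have hvint : IntegrableOn (fun x ↦ |v x| ^ 6) U μ :=
    ((hvc.abs.pow 6).continuousOn.integrableOn_compact hOc).mono_set
      (inter_subset_left.trans subset_closure)
  have hLpos : 0 < L := by
    have h := setIntegral_ge_of_const_le_real (c := a ^ 6) hUm hμUlt.ne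
      (fun x hx ↦ pow_le_pow_left₀ ha0.le (le_of_lt hx.2) 6) hvint
    have : 0 < a ^ 6 * μ.real U := mul_pos (pow_pos ha0 6) hμUreal
    linarith
  have hlim : Tendsto (fun ρ : ℝ ↦ ∫ x in U, |χ (‖e.coord x‖ / ρ) * v x| ^ 6 ∂μ) atTop (𝓝 L) := by
    refine tendsto_integral_filter_of_dominated_convergence (fun _ ↦ Bv ^ 6) ?_ ?_ ?_ ?_
    · filter_upwards [eventually_gt_atTop e.R] with ρ hρ
      exact (((e.contMDiff_radialCutoff hχ h1 hρ).continuous.mul hvc).abs.pow 6).aestronglyMeasurable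
    · filter_upwards with ρ
      refine ae_restrict_of_forall_mem hUm fun x hx ↦ ?_
      have hvx : |v x| ≤ Bv := (Real.norm_eq_abs _).symm.le.trans
        (hBv x (subset_closure hx.1))
      rw [Real.norm_eq_abs, abs_pow, abs_abs, abs_mul]
      refine pow_le_pow_left₀ (by positivity) ?_ 6
      calc |χ (‖e.coord x‖ / ρ)| * |v x| ≤ 1 * |v x| :=
            mul_le_mul_of_nonneg_right (hχb _) (abs_nonneg _)
        _ ≤ Bv := by rw [one_mul]; exact hvx
    · exact integrableOn_const hμUlt.ne
    · refine Eventually.of_forall fun x ↦ ?_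
      refine tendsto_const_nhds.congr' ?_
      filter_upwards [e.eventually_radialCutoff_eq_one h1 x] with ρ hρ
      rw [hρ, one_mul]
  -- the upper bound `∫_U |χ_ρ v|⁶ ≤ (c K/((1 − θ) ρ))³ → 0`
  have hup : ∀ᶠ ρ : ℝ in atTop,
      ∫ x in U, |χ (‖e.coord x‖ / ρ) * v x| ^ 6 ∂μ ≤ (c * K / ((1 - θ) * ρ)) ^ 3 := by
    filter_upwards [eventually_gt_atTop R₂] with ρ hρ
    have hρR : e.R < ρ := hRR₂.trans hρ
    have hρ0 : 0 < ρ := e.R_pos.trans hρR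
    have hcont : Continuous fun x ↦ |χ (‖e.coord x‖ / ρ) * v x| ^ 6 :=
      (((e.contMDiff_radialCutoff hχ h1 hρR).continuous.mul hvc).abs.pow 6)
    have hcs : HasCompactSupport fun x ↦ |χ (‖e.coord x‖ / ρ) * v x| ^ 6 :=
      ((e.hasCompactSupport_radialCutoff h2 hsole hρ0).mul_right (f' := v)).comp_left
        (g := fun t : ℝ ↦ |t| ^ 6) (by simp)
    refine (setIntegral_le_integral (hcont.integrable_of_hasCompactSupport hcs)
      (Eventually.of_forall fun x ↦ by positivity)).trans (hkey ρ hρ)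
  have hzero : Tendsto (fun ρ : ℝ ↦ (c * K / ((1 - θ) * ρ)) ^ 3) atTop (𝓝 0) := by
    have h1θ : 0 < 1 - θ := sub_pos.2 hθ1
    have h : Tendsto (fun ρ : ℝ ↦ c * K / ((1 - θ) * ρ)) atTop (𝓝 0) :=
      tendsto_const_nhds.div_atTop (tendsto_id.const_mul_atTop h1θ)
    simpa using h.pow 3
  have hL0 : L ≤ 0 := le_of_tendsto_of_tendsto hlim hzero hup
  exact absurd hL0 (not_le.2 hLpos)

/-- **Two `O(1/r)` solutions of `Δ_h v − f v = g` coincide** (Schoen–Yau 1979, Lemma 3.2,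
uniqueness): under the hypotheses of `eq_zero_of_dalembertian_eq_mul` on `(X, h, e, c₁, f)`, if
`v₁, v₂ ∈ C²(X)` both solve `Δ_h v − f v = g` and are `O(1/r)` in the chart of the end, then
`v₁ = v₂` (their difference solves the homogeneous equation).
[cite: SchoenYauPMT1979, Lemma 3.2 (pp. 64–65)] -/
theorem eq_of_dalembertian_sub_mul_eq {α : ℝ} (hα : 0 < α)
    (hAF : e.IsMetricAsymptoticallyFlat D α) (hsole : e.IsSoleEnd) {c₁ : ℝ}
    (hS : ∀ ζ : X → ℝ, ContMDiff (𝓡 3) 𝓘(ℝ, ℝ) 1 ζ → HasCompactSupport ζ →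
      (∫ x, |ζ x| ^ 6 ∂riemannianMeasure D.h) ^ (1 / 3 : ℝ) ≤
        c₁ * ∫ x, D.metric.innerDual x (mvfderiv (𝓡 3) ζ x).toLinearMap
          (mvfderiv (𝓡 3) ζ x).toLinearMap ∂riemannianMeasure D.h)
    {f : X → ℝ} (hf : Continuous f)
    (hfi : Integrable (fun x ↦ max (-f x) 0 ^ (3 / 2 : ℝ)) (riemannianMeasure D.h))
    (hθ : c₁ * (∫ x, max (-f x) 0 ^ (3 / 2 : ℝ) ∂riemannianMeasure D.h) ^ (2 / 3 : ℝ) < 1)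
    {g v₁ v₂ : X → ℝ} (hv₁ : ContMDiff (𝓡 3) 𝓘(ℝ, ℝ) 2 v₁) (hv₂ : ContMDiff (𝓡 3) 𝓘(ℝ, ℝ) 2 v₂)
    (hpde₁ : ∀ x, D.metric.dalembertian v₁ x - f x * v₁ x = g x)
    (hpde₂ : ∀ x, D.metric.dalembertian v₂ x - f x * v₂ x = g x)
    (hdec₁ : endValue e v₁ =O[cobounded E3] fun z ↦ ‖z‖⁻¹)
    (hdec₂ : endValue e v₂ =O[cobounded E3] fun z ↦ ‖z‖⁻¹) :
    v₁ = v₂ := by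
  haveI : (PseudoRiemannianMetric.ofRiemannian D.h).HasLeviCivita := ‹D.metric.HasLeviCivita›
  have hv : ContMDiff (𝓡 3) 𝓘(ℝ, ℝ) 2 (v₁ - v₂) := hv₁.sub hv₂
  have hpde : ∀ x, D.metric.dalembertian (v₁ - v₂) x = f x * (v₁ - v₂) x := by
    intro x
    have hΔ : D.metric.dalembertian (v₁ - v₂) x =
        D.metric.dalembertian v₁ x - D.metric.dalembertian v₂ x :=
      dalembertian_sub D.metric (hv₁ x) (hv₂ x)
    rw [hΔ, Pi.sub_apply]
    have h1 := hpde₁ x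
    have h2 := hpde₂ x
    linear_combination h1 - h2
  have hdec : endValue e (v₁ - v₂) =O[cobounded E3] fun z ↦ ‖z‖⁻¹ := by
    have h := hdec₁.sub hdec₂
    refine h.congr_left fun z ↦ ?_
    by_cases hz : e.R < ‖z‖
    · simp [endValue_of_lt e _ hz]
    · simp [endValue_of_not_lt e _ hz]
  have h := e.eq_zero_of_dalembertian_eq_mul D hα hAF hsole hS hf hfi hθ hv hpde hdec
  exact sub_eq_zero.1 h

/-- **Schoen–Yau 1979, Lemma 3.2 (uniqueness), as printed**: on a connected `3`-manifold `X`
with data `(h, k)` whose only end `e` is asymptotically flat (`h − δ = O₂(r^{−α})`, `α > 0`),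
*"there is a number `ε₀ > 0` depending only on `N` and the constants of (1.1) so that if
`(∫_N |f₋|^{3/2})^{2/3} ≤ ε₀`, then (3.2) `Δv − fv = h` has a unique solution `v` satisfying
`v = O(1/r)`"* — here the uniqueness assertion: for continuous `f` with `∫ f₋^{3/2} dV < ∞` and
`(∫ f₋^{3/2} dV)^{2/3} ≤ ε₀`, any two `C²` solutions of `Δ_h v − f v = g` that are `O(1/r)` in the
chart of the end coincide. The constant is `ε₀ = 1/(2(c₁ + 1))` with `c₁` the Sobolev constant
of Lemma 3.1 (`AFEnd.sobolev_inequality`). [cite: SchoenYauPMT1979, Lemma 3.2 (pp. 64–65)] -/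
theorem exists_eps_forall_eq_of_dalembertian_sub_mul_eq [ConnectedSpace X] {α : ℝ} (hα : 0 < α)
    (hAF : e.IsMetricAsymptoticallyFlat D α)
    (hsole : e.IsSoleEnd) :
    ∃ ε₀ : ℝ, 0 < ε₀ ∧ ∀ (f g v₁ v₂ : X → ℝ), Continuous f →
      Integrable (fun x ↦ max (-f x) 0 ^ (3 / 2 : ℝ)) (riemannianMeasure D.h) →
      (∫ x, max (-f x) 0 ^ (3 / 2 : ℝ) ∂riemannianMeasure D.h) ^ (2 / 3 : ℝ) ≤ ε₀ →
      ContMDiff (𝓡 3) 𝓘(ℝ, ℝ) 2 v₁ → ContMDiff (𝓡 3) 𝓘(ℝ, ℝ) 2 v₂ →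
      (∀ x, D.metric.dalembertian v₁ x - f x * v₁ x = g x) →
      (∀ x, D.metric.dalembertian v₂ x - f x * v₂ x = g x) →
      (endValue e v₁ =O[cobounded E3] fun z ↦ ‖z‖⁻¹) →
      (endValue e v₂ =O[cobounded E3] fun z ↦ ‖z‖⁻¹) → v₁ = v₂ := by
  obtain ⟨c₁, hc₁, hS⟩ := e.sobolev_inequality D hα hAF hsole
  refine ⟨1 / (2 * (c₁ + 1)), by positivity, fun f g v₁ v₂ hf hfi hε hv₁ hv₂ h₁ h₂ hd₁ hd₂ ↦ ?_⟩
  refine e.eq_of_dalembertian_sub_mul_eq D hα hAF hsole hS hf hfi ?_ hv₁ hv₂ h₁ h₂ hd₁ hd₂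
  have hN0 : 0 ≤ (∫ x, max (-f x) 0 ^ (3 / 2 : ℝ) ∂riemannianMeasure D.h) ^ (2 / 3 : ℝ) :=
    Real.rpow_nonneg (integral_nonneg fun x ↦ Real.rpow_nonneg (le_max_right _ _) _) _
  calc c₁ * (∫ x, max (-f x) 0 ^ (3 / 2 : ℝ) ∂riemannianMeasure D.h) ^ (2 / 3 : ℝ)
      ≤ c₁ * (1 / (2 * (c₁ + 1))) := mul_le_mul_of_nonneg_left hε hc₁
    _ < 1 := by
        rw [mul_one_div, div_lt_one (by positivity)]
        linarith

end AFEnd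

end Literature.Geometry.Lorentzian

end
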